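import Summits.BirchSwinnertonDyer.BirchSwinnertonDyer.Theorems.GoldfeldK12AdditiveTwoDescent
import HarnessLib

set_option linter.dupNamespace false
set_option autoImplicit false

/-!
# Crux K12₂″, skeleton line `heegner-field-at-two` (planner g7, `ROUTE-S1PLUS/lines-g7/K12pp_line.lean`,
# sha16 effc5612bd354786): the three PRINT stubs closed from named facts, the fourth identified

Cell `bsd-goldfeld`, prover seat `s1p-c201`, file 4 (proof-only; companion of
`GoldfeldK12AdditiveTwoDescent`, p418688). The registered-quality skeleton of item
stmt-BirchSwinnertonDyer-20044 along "route B at `p = 2`" has four stubs; its composition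
`RankOneTwoConverseCMSevenAdditiveTwo_of h1 h2 h3 h4` concludes the crux by name. As the planner asked
("land them as `theorem stub_…_of_facts : <facts> → <stub statement>`"), this file proves, with the stub
statements VERBATIM as conclusions:

* stub (1) `stub_rootNumber_eq_neg_one` ⟸ the `2`-parity fact `p_parity W 2` (Dokchitser–Dokchitser 2010,
  Thm. 1.4 + Cor. 4.20): `stub_rootNumber_eq_neg_one_of_p_parity`;
* stub (2) `stub_exists_auxField` ⟸ Modularity + Hoffstein–Luo 1997 + EITHER Kato's finiteness at `2`
  (`stub_exists_auxField_of_kato`) OR — the CM-native input, a binder of the route's `PublishedFactsAllTwists`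
  — the rank-zero CM BSD triple `bsdTriple_of_hasCM_of_L_one_ne_zero` (Rubin 1987 / Burungale–Flach 2024),
  read on a globally minimal model of the CM twin (`stub_exists_auxField_of_bsdTriple`);
* stub (4) `stub_analyticRankEK_eq_of_twin` ⟸ analytic continuation `hasEntireLFunction_rat` (Artin
  formalism `analyticRankEK_eq_add_of`): `stub_analyticRankEK_eq_of_twin_of_modularity`;
* stub (3) `stub_kLevelTwoConverse` (XL, the content) is LITERALLY the leaf `KLevelTwoConverseCMSevenSplit`
  of file `GoldfeldK12AdditiveTwoDescent` (`stub_kLevelTwoConverse_iff_leaf`, `Iff.rfl`), where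
  `rankOneTwoConverseCMSevenAdditiveTwo_iff_kLevelTwoConverseSplit` shows it is EQUIVALENT to the crux
  modulo these facts.

So the line is closed modulo exactly its hardest stub; nothing is asserted about stub (3).

References: T. and V. Dokchitser, Ann. of Math. 172 (2010) Thm. 1.4, Cor. 4.20
[DokchitserDokchitserAnnals2010]; J. Hoffstein, W. Luo, Math. Res. Lett. 4 (1997) [HoffsteinLuo1997];
K. Kato, Astérisque 295 (2004) Cor. 14.3 [Kato2004Asterisque]; K. Rubin, Invent. Math. 89 (1987) Thm. A;
A. Burungale, M. Flach, Camb. J. Math. 12 (2024) Cor. 2 [BurungaleFlach2024]; B. Gross, D. Zagier,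
Invent. Math. 84 (1986) I.§7 [GrossZagier1986].
-/

noncomputable section

open scoped Classical

open WeierstrassCurve Literature.NumberTheory.EllipticCurves

namespace Summit.BirchSwinnertonDyer.BirchSwinnertonDyer.Theorems.GoldfeldGoodTwists

/-- **Stub (1) of line `heegner-field-at-two` from the `2`-parity fact**: `corank_{ℤ₂} Sel_{2^∞} = 1`
forces `w(W) = −1` (for EVERY `W/ℚ`; the cell hypotheses are not used).
[cite: DokchitserDokchitserAnnals2010, Thm. 1.4 and Cor. 4.20] -/
theorem stub_rootNumber_eq_neg_one_of_p_parity
    (hpar : ∀ (W : WeierstrassCurve ℚ) [W.IsElliptic], p_parity W 2) :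
    ∀ (W : WeierstrassCurve ℚ) [W.IsElliptic] [W.IsGloballyMinimal], W.j = -3375 →
      ¬ W.HasGoodReductionAtPrime 2 → W.selmerCorank 2 = 1 → W.rootNumber = -1 := by
  intro W _ _ _ _ hcorank
  have h := hpar W
  unfold p_parity at h
  rw [hcorank, pow_one] at h
  exact h.symm

/-- **Stub (2) from Modularity, Hoffstein–Luo and Kato at `2`**: for `w(W) = −1` an imaginary quadratic
`K` with every `ℓ ∣ N_W` split, `2` split, `d_K ≡ 1 (mod 8)`, `L(W^{(d_K)}, 1) ≠ 0`
(`exists_heegnerField_split_twist_ne_zero_discr_emod_eight_of_hoffsteinLuo`, `p = 2`) and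
`corank Sel_{2^∞}(W^{(d_K)}/ℚ) = 0` (Kato: `Sel_{2^∞}` finite when `L(1) ≠ 0`).
[cite: HoffsteinLuo1997, Theorem (§1, pp. 435–436)] [cite: Kato2004Asterisque, Cor. 14.3 (p. 235)] -/
theorem stub_exists_auxField_of_kato (hmod : ModularForms.exists_isNewformOf)
    (hHL : HoffsteinLuo1997_exists_twist_L_one_ne_zero)
    (hKato : ∀ (W : WeierstrassCurve ℚ) [W.IsElliptic], kato_finite_of_L_one_ne_zero W 2) :
    ∀ (W : WeierstrassCurve ℚ) [W.IsElliptic] [W.IsGloballyMinimal], W.j = -3375 →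
      ¬ W.HasGoodReductionAtPrime 2 → W.rootNumber = -1 →
      ∃ (K : Type) (_ : Field K) (_ : NumberField K), IsImaginaryQuadratic K ∧
        SatisfiesHeegnerHypothesis (W.conductorNorm ℤ) K ∧ SatisfiesHeegnerHypothesis 2 K ∧
        NumberField.discr K % 8 = 1 ∧
        (W.quadraticTwist (NumberField.discr K : ℚ)).entireLFunction 1 ≠ 0 ∧
        (W.quadraticTwist (NumberField.discr K : ℚ)).selmerCorank 2 = 0 := by
  intro W _ _ _ _ hw
  obtain ⟨K, _, _, hK, -, hHN, hHp, hd8, hL1⟩ :=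
    exists_heegnerField_split_twist_ne_zero_discr_emod_eight_of_hoffsteinLuo hmod hHL W hw
      Nat.prime_two 0
  have hd : (NumberField.discr K : ℚ) ≠ 0 := by exact_mod_cast NumberField.discr_ne_zero K
  haveI := W.isElliptic_quadraticTwist hd
  obtain ⟨-, -, hfin⟩ := hKato (W.quadraticTwist (NumberField.discr K : ℚ)) hL1
  haveI := hfin
  exact ⟨K, inferInstance, inferInstance, hK, hHN, hHp, hd8, hL1,
    (W.quadraticTwist (NumberField.discr K : ℚ)).selmerCorank_eq_zero_of_finite 2⟩

/-- **Stub (2) from Modularity, Hoffstein–Luo and the CM rank-zero BSD triple** (the route's own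
binder `bsdTriple_of_hasCM_of_L_one_ne_zero`: Rubin 1987 Thm. A / Burungale–Flach 2024 Cor. 2, instead of
Kato): the twin `W^{(d_K)}` has `j = −3375`, hence CM; on a globally minimal model `W'` of it,
`L(W', 1) ≠ 0` gives `rank = ord L = 0` and `Ш` finite, so `corank Sel_{2^∞} = 0` (Greenberg's corank
identity), and the corank is an isomorphism invariant.
[cite: HoffsteinLuo1997, Theorem (§1, pp. 435–436)] [cite: BurungaleFlach2024, Cor. 2]
[cite: Greenberg1999LNM, §1 pp. 54–57] -/
theorem stub_exists_auxField_of_bsdTriple (hmod : ModularForms.exists_isNewformOf)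
    (hHL : HoffsteinLuo1997_exists_twist_L_one_ne_zero) (hBF : bsdTriple_of_hasCM_of_L_one_ne_zero) :
    ∀ (W : WeierstrassCurve ℚ) [W.IsElliptic] [W.IsGloballyMinimal], W.j = -3375 →
      ¬ W.HasGoodReductionAtPrime 2 → W.rootNumber = -1 →
      ∃ (K : Type) (_ : Field K) (_ : NumberField K), IsImaginaryQuadratic K ∧
        SatisfiesHeegnerHypothesis (W.conductorNorm ℤ) K ∧ SatisfiesHeegnerHypothesis 2 K ∧
        NumberField.discr K % 8 = 1 ∧
        (W.quadraticTwist (NumberField.discr K : ℚ)).entireLFunction 1 ≠ 0 ∧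
        (W.quadraticTwist (NumberField.discr K : ℚ)).selmerCorank 2 = 0 := by
  intro W _ _ hj _ hw
  obtain ⟨K, _, _, hK, -, hHN, hHp, hd8, hL1⟩ :=
    exists_heegnerField_split_twist_ne_zero_discr_emod_eight_of_hoffsteinLuo hmod hHL W hw
      Nat.prime_two 0
  have hd : (NumberField.discr K : ℚ) ≠ 0 := by exact_mod_cast NumberField.discr_ne_zero K
  haveI := W.isElliptic_quadraticTwist hd
  -- a globally minimal model `W'` of the twin: CM, `L(W', 1) ≠ 0`
  obtain ⟨W', _, _, C, hC⟩ := exists_isGloballyMinimal_smul_eq_quadraticTwist W hd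
  have hj' : W'.j = -3375 := by
    rw [j_eq_of_smul_eq _ W' C hC, W.j_quadraticTwist hd, hj]
  have hL' : W'.entireLFunction 1 ≠ 0 := by
    rw [← entireLFunction_smul W' C, hC]; exact hL1
  -- BSD triple ⟹ `rank = ord L = 0`, `Ш` finite ⟹ corank `0`
  obtain ⟨hrk, hfin, -⟩ := W'.bsdTriple_iff.mp (hBF W' (hasCM_of_j_eq_neg3375 W' hj') hL')
  have har' : W'.analyticRank = 0 := analyticRank_eq_zero_of_entireLFunction_one_ne_zero W' hL'
  haveI : Finite W'.sha := hfin
  have hcor' : W'.selmerCorank 2 = 0 := by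
    rw [selmerCorank_eq_mordellWeilRank_of_finite_shaPrimary W' 2 inferInstance, ← hrk, har']
  exact ⟨K, inferInstance, inferInstance, hK, hHN, hHp, hd8, hL1, by
    rw [← selmerCorank_eq_of_variableChange 2 hC]; exact hcor'⟩

/-- **Stub (4) from analytic continuation** (Artin formalism `ord L(W/K) = ord L(W) + ord L(W^{(d_K)})`
and `ord L(W^{(d_K)}) = 0` when `L(W^{(d_K)}, 1) ≠ 0`). [cite: GrossZagier1986, I.§7] -/
theorem stub_analyticRankEK_eq_of_twin_of_modularity (hmod : hasEntireLFunction_rat) :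
    ∀ (W : WeierstrassCurve ℚ) [W.IsElliptic] (K : Type) [Field K] [NumberField K],
      (W.quadraticTwist (NumberField.discr K : ℚ)).entireLFunction 1 ≠ 0 →
      analyticRankEK W K = W.analyticRank := by
  intro W _ K _ _ hL1
  rw [analyticRankEK_eq_add_of hmod W K, analyticRank_eq_zero_of_entireLFunction_one_ne_zero _ hL1,
    add_zero]

/-- **Stub (3) is the leaf `KLevelTwoConverseCMSevenSplit`** of `GoldfeldK12AdditiveTwoDescent`
(definitionally): the open content of the line is exactly that `@[conjecture]`, which
`rankOneTwoConverseCMSevenAdditiveTwo_iff_kLevelTwoConverseSplit` shows to be equivalent to the crux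
modulo the facts closing stubs (1), (2), (4). [cite: BurungaleCastellaSkinnerTian2022, Rem. D (p. 327)] -/
theorem stub_kLevelTwoConverse_iff_leaf :
    (∀ (W : WeierstrassCurve ℚ) [W.IsElliptic] [W.IsGloballyMinimal], W.j = -3375 →
        ¬ W.HasGoodReductionAtPrime 2 →
        ∀ (K : Type) [Field K] [NumberField K], IsImaginaryQuadratic K →
          SatisfiesHeegnerHypothesis (W.conductorNorm ℤ) K → SatisfiesHeegnerHypothesis 2 K →
          NumberField.discr K % 8 = 1 →
          (W.quadraticTwist (NumberField.discr K : ℚ)).entireLFunction 1 ≠ 0 →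
          (W.baseChange K).selmerCorank 2 = 1 → analyticRankEK W K = 1) ↔
      KLevelTwoConverseCMSevenSplit :=
  Iff.rfl

/-- **The skeleton's composition with stubs (1), (2), (4) discharged**: along line
`heegner-field-at-two`, the crux K12₂″ (route decl, by name) follows from `2`-parity, Modularity
(newform existence for the auxiliary field; analytic continuation for Artin formalism), Hoffstein–Luo,
the CM rank-zero BSD triple, and stub (3). Same content as file Descent's
`rankOneTwoConverseCMSevenAdditiveTwo_of_kLevelTwoConverseSplit`, assembled in the skeleton's own shape
`h1, h2, h3, h4`. [cite: DokchitserDokchitserAnnals2010, Thm. 1.4 and Cor. 4.20]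
[cite: HoffsteinLuo1997, Theorem (§1, pp. 435–436)] [cite: BurungaleFlach2024, Cor. 2] -/
theorem rankOneTwoConverseCMSevenAdditiveTwo_of_line_heegnerFieldAtTwo
    (hpar : ∀ (W : WeierstrassCurve ℚ) [W.IsElliptic], p_parity W 2)
    (hmod : ModularForms.exists_isNewformOf) (hHL : HoffsteinLuo1997_exists_twist_L_one_ne_zero)
    (hBF : bsdTriple_of_hasCM_of_L_one_ne_zero) (hcont : hasEntireLFunction_rat)
    (h3 : KLevelTwoConverseCMSevenSplit) :
    Summit.BirchSwinnertonDyer.BirchSwinnertonDyer.Theses.GoldfeldAllTwistsTwoConverse.RankOneTwoConverseCMSevenAdditiveTwo := by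
  intro W _ _ hj hbad hcorank
  have hw : W.rootNumber = -1 := stub_rootNumber_eq_neg_one_of_p_parity hpar W hj hbad hcorank
  obtain ⟨K, _, _, hK, hHN, hH2, hd8, hL1, h0⟩ :=
    stub_exists_auxField_of_bsdTriple hmod hHL hBF W hj hbad hw
  have hK1 : (W.baseChange K).selmerCorank 2 = 1 := by
    rw [selmerCorank_baseChange_quadratic_holds W K hK.1 2, hcorank, h0]
  have hEK : analyticRankEK W K = 1 := h3 W hj hbad K hK hHN hH2 hd8 hL1 hK1
  rwa [stub_analyticRankEK_eq_of_twin_of_modularity hcont W K hL1] at hEK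

end Summit.BirchSwinnertonDyer.BirchSwinnertonDyer.Theorems.GoldfeldGoodTwists

end
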